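import Summits.CriticalPhenomena.CardyFormulaZ2.Theorems.CardyComplexConeParafermionToSLESixFamiliesDiamondTurnCountGeom
import Summits.CriticalPhenomena.CardyFormulaZ2.Theorems.CardyComplexConeParafermionToSLESixFamiliesDiamondTurnCountMesh
import HarnessLib

/-!
# The touch site of a free side: local lattice analysis in the frame
# (line `potential-darboux-picard-diamond`, S1t `stub_freeSideTurnCount`, part 9)

Crux `ParafermionToSLESixFamilies` (stmt-CriticalPhenomena-11389), line `potential-darboux-picard-diamond`, stub
`stub_freeSideTurnCount` (S1t). A TOUCH SITE `u` of the boundary segment `[p, q]` on side `k` of a marked diamond (data `E`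
with `E.Ω` the diamond, mesh `δ`, all lattice points of the diamond in `Ω_δ`, the discrete arcs near the bulk of the segment
known: off `A`, boundary sites on `B`) is a site of the diamond within `3δ` of the segment, `η`-away from its ends, whose
neighbour `u + u_{k+3}` is a `B`-site. `touchSite_local` (registered) proves what the escape staircase needs about it:

* the frame coordinates of `u` (`gam - 3δ ≤ Fk < gam`, `Gk` in the `η - 6δ`-trimmed range of the segment);
* the half-plane `xiC - upC ≥ xiC u - upC u + 3` (two steps out from the `B`-site) is outside the diamond — the `B`-site
  is a discrete-boundary site, so its block contains an outside point, which can only violate the constraint of side `k`;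
* the site `u + u_{k+3} + u_k` is forbidden (outside, or a discrete-boundary site near the segment, hence on `B`);
* the `B`-site is a site of the diamond, and no site of the frame block of radius one around `u` is on `A`.
-/

noncomputable section

namespace Summit.CriticalPhenomena.CardyFormulaZ2.Cruxes.ParafermionToSLESixFamilies.PotentialDarbouxPicardDiamond

open Set Metric Complex
open Literature.Probability Literature.Probability.LatticeModels Literature.Probability.Percolation
open Literature.Probability.LatticeModels.DiscreteDobrushin
open Literature.Probability.RandomPlanarGeometry

/-- Frame differences between lattice points are controlled by the frame coordinates: `|ΔF| ≤ δ |Δ(xiC - upC)|`-type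
bound in the form `ΔF = (√2/2) δ Δ`, `√2/2 < 1`. -/
theorem abs_frame_sub_le {c : ℂ} {δ : ℝ} (hδ : 0 < δ) (k : Fin 4) (v w : Site 2) {m : ℕ}
    (hN : |(xiC k v - upC k v) - (xiC k w - upC k w)| ≤ m) (hT : |(xiC k v + upC k v) - (xiC k w + upC k w)| ≤ m) :
    |Fk k (dRot c (meshPoint δ v)) - Fk k (dRot c (meshPoint δ w))| ≤ m * δ ∧
      |Gk k (dRot c (meshPoint δ v)) - Gk k (dRot c (meshPoint δ w))| ≤ m * δ := by
  obtain ⟨h1, h2⟩ := sqrt_two_div_two_mul_bounds hδ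
  have hN' : |(((xiC k v - upC k v) - (xiC k w - upC k w) : ℤ) : ℝ)| ≤ m := by exact_mod_cast hN
  have hT' : |(((xiC k v + upC k v) - (xiC k w + upC k w) : ℤ) : ℝ)| ≤ m := by exact_mod_cast hT
  have hh : |Real.sqrt 2 / 2 * δ| = Real.sqrt 2 / 2 * δ := abs_of_pos (by positivity)
  rw [Fk_meshPoint_sub, Gk_meshPoint_sub]
  constructor
  · rw [abs_mul, hh]
    nlinarith [abs_nonneg (((xiC k v - upC k v - (xiC k w - upC k w) : ℤ) : ℝ))]
  · rw [abs_mul, hh]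
    nlinarith [abs_nonneg (((xiC k v + upC k v - (xiC k w + upC k w) : ℤ) : ℝ))]

/-- **The touch site of a free side, locally** (registered helper of `stub_freeSideTurnCount`). See the module docstring. -/
theorem touchSite_local : ∀ (D : DobrushinDomain) (c : ℂ) (α β : ℝ), D.carrier = {z | |((z - c) * exp (-(Real.pi / 4 : ℝ) * I)).re| < α ∧ |((z - c) * exp (-(Real.pi / 4 : ℝ) * I)).im| < β} → ∀ (k : Fin 4) (sp sq : ℝ) (p q : ℂ), 0 ≤ sp → sq ≤ dLen α β k → dRot c p = dParam α β k sp → dRot c q = dParam α β k sq → sp ≤ sq → ∀ (E : DiscreteDobrushin) (δ η : ℝ), 0 < δ → 100 * δ ≤ η → 10 * δ ≤ gam α β k → E.Ω = D.carrier → E.δ = δ → (∀ x : Site 2, meshPoint δ x ∈ D.carrier → x ∈ meshDomain D.carrier δ) → (∀ x : Site 2, infDist (meshPoint δ x) (segment ℝ p q) ≤ 6 * δ → η / 2 ≤ dist (meshPoint δ x) p → η / 2 ≤ dist (meshPoint δ x) q → x ∉ E.zdArcA ∧ (x ∈ E.zdBoundary → x ∈ E.zdArcB)) → ∀ (u : Site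 2), infDist (meshPoint δ u) (segment ℝ p q) ≤ 3 * δ → η ≤ dist (meshPoint δ u) p → η ≤ dist (meshPoint δ u) q → meshPoint δ u ∈ D.carrier → u + cornerUnit (k + 3) ∈ E.zdArcB → (gam α β k - 3 * δ ≤ Fk k (dRot c (meshPoint δ u)) ∧ Fk k (dRot c (meshPoint δ u)) < gam α β k ∧ sp + η - 6 * δ - gam' α β k ≤ Gk k (dRot c (meshPoint δ u)) ∧ Gk k (dRot c (meshPoint δ u)) ≤ sq - η + 6 * δ - gam' α β k) ∧ (∀ v : Site 2, xiC k u - upC k u + 3 ≤ xiC k v - upC k v → meshPoint δ v ∉ D.carrier) ∧ ((∀ i : Fin 4, ¬ E.IsInnerFace (faceAt (u + cornerUnit (k + 3) + cornerUnit k) i)) ∨ u + cornerUnit (k + 3) + cornerUnit k ∈ E.zdArcB) ∧ meshPoint δ (u + cornerUnit (k + 3)) ∈ D.carrier ∧ (∀ v : Site 2, |xiC k v - xiC k u| ≤ 1 → |upC k v - upC k u| ≤ 1 → v ∉ E.zdArcA) := by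
  intro D c α β hcar k sp sq p q hsp0 hsqL hpk hqk hspq E δ η hδ hδη hδγ hEΩ hEδ hgood harcs u hdist hηp hηq huin hb
  have hcar' : D.carrier = {z | |(dRot c z).re| < α ∧ |(dRot c z).im| < β} := hcar
  have hconv : Convex ℝ D.carrier := by rw [hcar]; exact convex_tiltedBox c _ α β
  rw [dLen_eq] at hsqL
  -- frame of `u`
  obtain ⟨hFu1, -, hGu1, hGu2⟩ := frame_of_near_segment α β c k sp sq p q hpk hqk hspq (meshPoint δ u) (3 * δ) η hdist hηp hηq
  have hFu2 : Fk k (dRot c (meshPoint δ u)) < gam α β k := by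
    have := (mem_carrier_iff_frame hcar' k _).1 huin
    exact (abs_lt.1 this.1).2
  -- nearby lattice points are near the bulk of the segment
  have hnear : ∀ v : Site 2, ‖meshPoint δ v - meshPoint δ u‖ ≤ 2 * δ →
      infDist (meshPoint δ v) (segment ℝ p q) ≤ 6 * δ ∧ η / 2 ≤ dist (meshPoint δ v) p ∧ η / 2 ≤ dist (meshPoint δ v) q := by
    intro v hv
    rw [← dist_eq_norm] at hv
    refine ⟨?_, ?_, ?_⟩
    · have := infDist_le_infDist_add_dist (s := segment ℝ p q) (x := meshPoint δ v) (y := meshPoint δ u)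
      linarith
    · have := dist_triangle (meshPoint δ u) (meshPoint δ v) p
      rw [dist_comm] at hv; linarith
    · have := dist_triangle (meshPoint δ u) (meshPoint δ v) q
      rw [dist_comm] at hv; linarith
  -- the `B`-site is a site of the diamond, and a discrete-boundary site
  have hb1in : meshPoint δ (u + cornerUnit (k + 3)) ∈ D.carrier := by
    have := mem_of_mem_zdBoundary (E.zdArcB_subset_zdBoundary hb)
    rwa [hEΩ, hEδ] at this
  -- an outside point in the block of the `B`-site violates the constraint of side `k`
  obtain ⟨y, hy1, hyout⟩ := exists_near_not_mem_of_mem_zdBoundary hconv hgood hEΩ hEδ (E.zdArcB_subset_zdBoundary hb)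
  obtain ⟨hyx, hyu⟩ := abs_xiC_upC_sub_le_one (k := k) hy1
  simp only [xiC_add_unit3, upC_add_unit3] at hyx hyu
  rw [abs_le] at hyx hyu
  obtain ⟨hFy, hGy⟩ := abs_frame_sub_le (c := c) hδ k y u (m := 3) (by rw [abs_le]; constructor <;> push_cast <;> omega)
    (by rw [abs_le]; constructor <;> push_cast <;> omega)
  rw [abs_le] at hFy hGy
  have hFy0 : gam α β k ≤ Fk k (dRot c (meshPoint δ y)) := by
    have hny := hyout
    rw [mem_carrier_iff_frame hcar' k, not_and_or, not_lt, not_lt] at hny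
    rcases hny with hny | hny
    · rcases (le_abs'.1 hny) with h | h
      · exfalso
        have : 0 < gam α β k := by linarith
        push_cast at hFy; linarith
      · exact h
    · exfalso
      rcases (le_abs'.1 hny) with h | h <;> push_cast at hGy <;> linarith
  -- the outward half-plane
  have hout : ∀ v : Site 2, xiC k u - upC k u + 3 ≤ xiC k v - upC k v → meshPoint δ v ∉ D.carrier := by
    intro v hv
    apply not_mem_carrier_of_frame hcar' k
    left
    have h1 := Fk_meshPoint_sub c δ k v y
    have h2 : (0:ℝ) ≤ Real.sqrt 2 / 2 * δ * (((xiC k v - upC k v - (xiC k y - upC k y)) : ℤ) : ℝ) := by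
      apply mul_nonneg (by positivity)
      exact_mod_cast (by omega : (0:ℤ) ≤ xiC k v - upC k v - (xiC k y - upC k y))
    linarith
  refine ⟨⟨hFu1, hFu2, by linarith, by linarith⟩, hout, ?_, hb1in, ?_⟩
  · -- the site two steps from `u`
    by_cases hw : meshPoint δ (u + cornerUnit (k + 3) + cornerUnit k) ∈ D.carrier
    · right
      have hwD : u + cornerUnit (k + 3) + cornerUnit k ∈ meshDomain E.Ω E.δ := by rw [hEΩ, hEδ]; exact hgood _ hw
      have ho : meshPoint E.δ (u + cornerUnit (k + 3) + cornerUnit k + cornerUnit k) ∉ E.Ω := by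
        rw [hEΩ, hEδ]
        apply hout
        simp only [xiC_add_unit0, xiC_add_unit3, upC_add_unit0, upC_add_unit3]; omega
      have hbd := mem_zdBoundary_of_adj_not_mem_carrier hwD (cSrc_mem_edgeSet (u + cornerUnit (k + 3) + cornerUnit k, k)) ho
      obtain ⟨h1, h2, h3⟩ := hnear _ (norm_meshPoint_add_add_sub_le hδ.le u (k + 3) k)
      exact (harcs _ h1 h2 h3).2 hbd
    · left
      rw [← hEΩ, ← hEδ] at hw
      exact forall_not_isInnerFace_of_not_mem hw
  · -- the block around `u` is off `A`
    intro v hv1 hv2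
    obtain ⟨h1, h2, h3⟩ := hnear v (norm_meshPoint_sub_le_of_xiC_upC hδ.le hv1 hv2)
    exact (harcs v h1 h2 h3).1

end Summit.CriticalPhenomena.CardyFormulaZ2.Cruxes.ParafermionToSLESixFamilies.PotentialDarbouxPicardDiamond

end
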